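import Mathlib
import Literature.Computability.AlgebraicComplexity.PermanentIrreducible
import Summits.ValiantsHypothesis.ValiantsHypothesis.Theses.RefutationDegree
import Summits.ValiantsHypothesis.ValiantsHypothesis.Theorems.RefutationDegreeSmallCaseThreeFiveStubDefectCoeff
import Summits.ValiantsHypothesis.ValiantsHypothesis.Theorems.RefutationDegreeSmallCaseThreeFiveStubCoefIsHomogeneous
import Summits.ValiantsHypothesis.ValiantsHypothesis.Theorems.RefutationDegreeSmallCaseThreeFiveStubHomogeneousComponentMul
import Summits.ValiantsHypothesis.ValiantsHypothesis.Theorems.RefutationDegreeSmallCaseThreeFiveStubMapMatrixPencil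

/-!
# `SmallCaseThreeFive` (stmt-ValiantsHypothesis-5644), line `Sketch` — stub
`stub_univNilp_of_smallCaseThreeFive` (the converse transfer)

The crux `SmallCaseThreeFive` is a degree-`55` Nullstellensatz certificate
`Σ_{μ ∈ supp P} h_μ · P_μ = 1` for the defect `P = det(A₀ + Σ_e x_e A_e) - per₃` of the generic
`5 × 5` affine pencil (`P_μ ∈ S = ℂ[250 unknowns]` its `x^μ`-coefficient).  We prove that such a
certificate forces UNIVERSAL NILPOTENCY with exponent `11`: in every *model* — a commutative
`ℂ`-algebra `T`, matrices `A₀, A_e ∈ T^{5×5}` and `λ ∈ T` with `det(A₀ + Σ_e x_e A_e) = λ · per₃`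
in `T[x]` — one has `λ ^ 11 = 0`.  Consequently a single model with `λ ^ 11 ≠ 0` refutes the crux.

Proof.  Let `φ : S → T` be the evaluation at the model and `c_μ = coeff_μ det` (a quintic form,
`stub_coef_isHomogeneous`), so `P_μ = c_μ - ε_μ` with `ε_μ = [μ is a permutation pattern]`
(`stub_defect_coeff`) and `φ(c_μ) = λ ε_μ` (push `det` through `φ`, `stub_mapMatrix_pencil`, and
read off the coefficients of `λ · per₃`).  Taking the degree-`m` homogeneous component of the
certificate and applying `φ` gives, with `u_m = Σ_{μ perm} φ((h_μ)_m)`: `u_0 = -1` and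
`u_{m+5} = λ u_m` (`stub_homogeneousComponent_mul`), hence `u_{55} = -λ^{11}`.  On the other hand
`u_{55} = 0`: for a permutation pattern `ρ`, `c_ρ ≠ 0` (evaluate at the diagonal pencil
`diag(x_{ρ0,0}, x_{ρ1,1}, x_{ρ2,2}, 1, 1)`), so `deg(h_ρ (c_ρ - 1)) ≤ 55` forces `deg h_ρ ≤ 50`
in the domain `S` (`MvPolynomial.totalDegree_mul_of_isDomain`), i.e. `(h_ρ)_{55} = 0`.
The algebraic skeleton of this argument is `cv_univNilp_core`; the main theorem instantiates it.
-/

noncomputable section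
set_option linter.dupNamespace false

namespace Summit.ValiantsHypothesis.ValiantsHypothesis.Theorems.RefutationDegreeSmallCaseThreeFive

open Literature.Computability.AlgebraicComplexity MvPolynomial
open scoped BigOperators Matrix

/-! ## Evaluating the generic pencil at a model -/

/-- Pushing a coefficient of `det` of the generic pencil through a ring map `f : S →+* T` gives
the corresponding coefficient of `det` of the pencil with entries `f`(unknowns)
(`RingHom.map_det`, `stub_mapMatrix_pencil`). -/
theorem cv_apply_coeff_det_pencil {T : Type*} [CommRing T]
    (f : MvPolynomial (Option (Fin 3 × Fin 3) × (Fin 5 × Fin 5)) ℂ →+* T)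
    (μ : Fin 3 × Fin 3 →₀ ℕ) :
    f (coeff μ (Matrix.of fun i j : Fin 5 =>
        C (X (none, (i, j))) + ∑ e : Fin 3 × Fin 3, X e * C (X (some e, (i, j))) :
          Matrix (Fin 5) (Fin 5) (MvPolynomial (Fin 3 × Fin 3)
            (MvPolynomial (Option (Fin 3 × Fin 3) × (Fin 5 × Fin 5)) ℂ))).det) =
      coeff μ (Matrix.of fun i j : Fin 5 =>
        C (f (X (none, (i, j)))) + ∑ e : Fin 3 × Fin 3, X e * C (f (X (some e, (i, j))))).det := by
  rw [← coeff_map, RingHom.map_det, stub_mapMatrix_pencil]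

/-- Step 1: if the pencil with entries `f`(unknowns) has `det = λ · per₃`, then `f` sends the
coefficient form `c_μ` to `λ` if `μ` is a permutation pattern and to `0` otherwise
(`coeff_permMonomial_perPoly`, `exists_permMonomial_eq_of_coeff_perPoly_ne_zero`). -/
theorem cv_apply_coeff_of_det_eq {T : Type*} [CommRing T]
    (f : MvPolynomial (Option (Fin 3 × Fin 3) × (Fin 5 × Fin 5)) ℂ →+* T) (l : T)
    (hdet : (Matrix.of fun i j : Fin 5 =>
        C (f (X (none, (i, j)))) + ∑ e : Fin 3 × Fin 3, X e * C (f (X (some e, (i, j))))).det =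
      C l * perPoly (Fin 3) T)
    (μ : Fin 3 × Fin 3 →₀ ℕ) :
    f (coeff μ (Matrix.of fun i j : Fin 5 =>
        C (X (none, (i, j))) + ∑ e : Fin 3 × Fin 3, X e * C (X (some e, (i, j))) :
          Matrix (Fin 5) (Fin 5) (MvPolynomial (Fin 3 × Fin 3)
            (MvPolynomial (Option (Fin 3 × Fin 3) × (Fin 5 × Fin 5)) ℂ))).det) =
      if μ ∈ Set.range (permMonomial (n := Fin 3)) then l else 0 := by
  rw [cv_apply_coeff_det_pencil, hdet, coeff_C_mul]
  split_ifs with hμ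
  · obtain ⟨ρ, rfl⟩ := hμ
    rw [coeff_permMonomial_perPoly, mul_one]
  · have hz : coeff μ (perPoly (Fin 3) T) = 0 := by
      by_contra hne
      exact hμ (Set.mem_range.2 (exists_permMonomial_eq_of_coeff_perPoly_ne_zero T hne))
    rw [hz, mul_zero]

/-! ## The permutation coefficients `c_ρ` are nonzero: a diagonal test pencil -/

/-- A model all of whose matrices are diagonal is a diagonal pencil. -/
theorem cv_pencil_diagonal {T : Type*} [CommRing T] (D₀ : Fin 5 → T)
    (D : Fin 3 × Fin 3 → Fin 5 → T) :
    (Matrix.of fun i j : Fin 5 => C (Matrix.diagonal D₀ i j) +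
        ∑ e : Fin 3 × Fin 3, X e * C (Matrix.diagonal (D e) i j) :
          Matrix (Fin 5) (Fin 5) (MvPolynomial (Fin 3 × Fin 3) T)) =
      Matrix.diagonal fun i => C (D₀ i) + ∑ e : Fin 3 × Fin 3, X e * C (D e i) := by
  ext i j
  by_cases hij : i = j
  · subst hij
    simp
  · simp [hij]

/-- The permutation monomial `x^{μ_ρ} = ∏_k x_{ρ k, k}`. -/
theorem cv_prod_X_eq_monomial {R : Type*} [CommSemiring R] (ρ : Equiv.Perm (Fin 3)) :
    ∏ k : Fin 3, (X (ρ k, k) : MvPolynomial (Fin 3 × Fin 3) R) = monomial (permMonomial ρ) 1 := by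
  rw [permMonomial, monomial_sum_one]
  rfl

/-- The test pencil `diag(x_{ρ0,0}, x_{ρ1,1}, x_{ρ2,2}, 1, 1)` of a permutation `ρ`, i.e.
`A₀ = diag(0,0,0,1,1)`, `A_{(ρ k,k)} = E_{kk}`, all other `A_e = 0`, has determinant `x^{μ_ρ}`. -/
theorem cv_det_testPencil (ρ : Equiv.Perm (Fin 3)) :
    (Matrix.diagonal fun i : Fin 5 => C ((![0, 0, 0, 1, 1] : Fin 5 → ℂ) i) +
        ∑ e : Fin 3 × Fin 3, X e * C ((![if e = (ρ 0, 0) then 1 else 0,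
          if e = (ρ 1, 1) then 1 else 0, if e = (ρ 2, 2) then 1 else 0, 0, 0] : Fin 5 → ℂ) i) :
      Matrix (Fin 5) (Fin 5) (MvPolynomial (Fin 3 × Fin 3) ℂ)).det =
      monomial (permMonomial ρ) 1 := by
  rw [Matrix.det_diagonal, Fin.prod_univ_five, ← cv_prod_X_eq_monomial, Fin.prod_univ_three]
  simp [apply_ite (C : ℂ → MvPolynomial (Fin 3 × Fin 3) ℂ), mul_ite, Finset.sum_ite_eq']

/-- The quintic forms `c_{μ_ρ}` (`ρ` a permutation) are nonzero: evaluated at the test pencil of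
`ρ` the coefficient of `x^{μ_ρ}` in `det` is `1`. -/
theorem cv_coeff_permMonomial_ne_zero (ρ : Equiv.Perm (Fin 3)) :
    coeff (permMonomial ρ) (Matrix.of fun i j : Fin 5 =>
        C (X (none, (i, j))) + ∑ e : Fin 3 × Fin 3, X e * C (X (some e, (i, j))) :
          Matrix (Fin 5) (Fin 5) (MvPolynomial (Fin 3 × Fin 3)
            (MvPolynomial (Option (Fin 3 × Fin 3) × (Fin 5 × Fin 5)) ℂ))).det ≠ 0 := by
  intro h0
  have h := cv_apply_coeff_det_pencil
    (eval fun v : Option (Fin 3 × Fin 3) × (Fin 5 × Fin 5) =>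
      Matrix.diagonal (v.1.elim (![0, 0, 0, 1, 1] : Fin 5 → ℂ) fun e =>
        (![if e = (ρ 0, 0) then 1 else 0, if e = (ρ 1, 1) then 1 else 0,
          if e = (ρ 2, 2) then 1 else 0, 0, 0] : Fin 5 → ℂ)) v.2.1 v.2.2)
    (permMonomial ρ)
  rw [h0, map_zero] at h
  simp only [eval_X, Option.elim_none, Option.elim_some] at h
  rw [cv_pencil_diagonal, cv_det_testPencil, coeff_monomial, if_pos rfl] at h
  exact zero_ne_one h

/-! ## Degree bookkeeping -/

/-- Homogeneous components below the degree of a homogeneous factor vanish (the graded-ring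
identity `DirectSum.coe_decompose_mul_of_right_mem_of_not_le` for the grading by total degree). -/
theorem cv_homogeneousComponent_mul_eq_zero {σ : Type*} {R : Type*} [CommSemiring R]
    (φ ψ : MvPolynomial σ R) {d n : ℕ} (hψ : ψ.IsHomogeneous d) (hn : n < d) :
    homogeneousComponent n (φ * ψ) = 0 := by
  letI : GradedAlgebra (homogeneousSubmodule σ R) := MvPolynomial.gradedAlgebra
  have key : ∀ (χ : MvPolynomial σ R) (i : ℕ),
      ((DirectSum.decompose (homogeneousSubmodule σ R) χ i : homogeneousSubmodule σ R i) :
        MvPolynomial σ R) = homogeneousComponent i χ :=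
    fun χ i => MvPolynomial.decomposition.decompose'_apply χ i
  have h := DirectSum.coe_decompose_mul_of_right_mem_of_not_le (homogeneousSubmodule σ R)
    (a := φ) (n := n) hψ (not_le.2 hn)
  simpa only [key] using h

/-- In a domain `K[unknowns]`: if `c ≠ 0` is a quintic form and `deg (f · (c - 1)) ≤ 55`, then
`deg f ≤ 50` (`MvPolynomial.totalDegree_mul_of_isDomain`; `deg (c - 1) ≥ deg c = 5`). -/
theorem cv_totalDegree_le_of_mul {σ K : Type*} [CommRing K] [NoZeroDivisors K]
    (f c : MvPolynomial σ K) (hc : c.IsHomogeneous 5) (hc0 : c ≠ 0)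
    (h : (f * (c - 1)).totalDegree ≤ 55) : f.totalDegree ≤ 50 := by
  by_cases hf : f = 0
  · simp [hf]
  have hc1 : c - 1 ≠ 0 := by
    intro h1
    have h5 : (5 : ℕ) = 0 := hc.inj_right (sub_eq_zero.1 h1 ▸ isHomogeneous_one σ K) hc0
    omega
  have hdeg5 : 5 ≤ (c - 1).totalDegree := by
    have h1 : c.totalDegree = 5 := hc.totalDegree hc0
    have h2 := totalDegree_add (c - 1) (1 : MvPolynomial σ K)
    rw [sub_add_cancel, totalDegree_one] at h2
    omega
  rw [totalDegree_mul_of_isDomain hf hc1] at h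
  omega

/-! ## The algebraic core of the converse transfer -/

/-- The core of the converse transfer, abstractly.  Let `c_μ` be quintic forms in a polynomial
domain `K[σ]`, nonzero for `μ ∈ p`, let `P_μ = c_μ - [μ ∈ p]`, and let `φ : K[σ] →+* T` send
`c_μ ↦ λ [μ ∈ p]`.  Then a certificate `Σ_{μ ∈ s} h_μ P_μ = 1` with `deg (h_μ P_μ) ≤ 55` forces
`λ ^ 11 = 0`: with `u_m := Σ_{μ ∈ s ∩ p} φ((h_μ)_m)`, the degree-`0` / degree-`(m+5)` components
of the certificate give `u_0 = -1` / `u_{m+5} = λ u_m`, so `u_{55} = -λ^{11}`; and `u_{55} = 0`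
since `deg h_μ ≤ 50` for `μ ∈ p` (`cv_totalDegree_le_of_mul`). -/
theorem cv_univNilp_core {ι σ K T : Type*} [CommRing K] [NoZeroDivisors K] [CommRing T]
    (φ : MvPolynomial σ K →+* T) (l : T) (p : ι → Prop) [DecidablePred p] (s : Finset ι)
    (c P h : ι → MvPolynomial σ K)
    (hc : ∀ μ, (c μ).IsHomogeneous 5) (hc0 : ∀ μ, p μ → c μ ≠ 0)
    (hφ : ∀ μ, φ (c μ) = if p μ then l else 0)
    (hP : ∀ μ, P μ = c μ - if p μ then 1 else 0)
    (hdeg : ∀ μ, (h μ * P μ).totalDegree ≤ 55) (hsum : ∑ μ ∈ s, h μ * P μ = 1) :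
    l ^ 11 = 0 := by
  -- the sums `u m = Σ_{μ ∈ s ∩ p} φ((h_μ)_m)`
  obtain ⟨u, hu⟩ : ∃ u : ℕ → T, ∀ m,
      u m = ∑ μ ∈ s, if p μ then φ (homogeneousComponent m (h μ)) else 0 :=
    ⟨_, fun _ => rfl⟩
  -- degree-`(m+5)` components of the summands, evaluated by `φ`
  have hterm : ∀ m μ, φ (homogeneousComponent (m + 5) (h μ * P μ)) =
      (if p μ then l * φ (homogeneousComponent m (h μ)) else 0) -
        if p μ then φ (homogeneousComponent (m + 5) (h μ)) else 0 := by
    intro m μ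
    rw [hP, mul_sub, map_sub, map_sub, stub_homogeneousComponent_mul _ _ (hc μ) m, map_mul, hφ]
    split_ifs <;> simp [mul_comm]
  -- degree-`0` components of the summands, evaluated by `φ`
  have hterm0 : ∀ μ, φ (homogeneousComponent 0 (h μ * P μ)) =
      -(if p μ then φ (homogeneousComponent 0 (h μ)) else 0) := by
    intro μ
    rw [hP, mul_sub, map_sub, map_sub,
      cv_homogeneousComponent_mul_eq_zero _ _ (hc μ) (by norm_num : 0 < 5), map_zero, zero_sub]
    split_ifs <;> simp
  -- the recursion `u (m+5) = λ u m`
  have hsucc : ∀ m, u (m + 5) = l * u m := by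
    intro m
    have h1 : homogeneousComponent (m + 5) (∑ μ ∈ s, h μ * P μ) = 0 := by
      rw [hsum]
      exact homogeneousComponent_eq_zero _ _ (by rw [totalDegree_one]; omega)
    have h2 := congr_arg φ h1
    rw [map_sum, map_sum, map_zero] at h2
    simp only [hterm, Finset.sum_sub_distrib, sub_eq_zero] at h2
    rw [hu, hu, ← h2, Finset.mul_sum]
    refine Finset.sum_congr rfl fun μ _ => ?_
    split_ifs <;> simp
  -- the start `u 0 = -1`
  have hzero : u 0 = -1 := by
    have h1 : homogeneousComponent 0 (∑ μ ∈ s, h μ * P μ) = 1 := by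
      rw [hsum]
      exact homogeneousComponent_eq_self (isHomogeneous_one _ _)
    have h2 := congr_arg φ h1
    rw [map_sum, map_sum, map_one] at h2
    simp only [hterm0, Finset.sum_neg_distrib] at h2
    exact (hu 0).trans (neg_eq_iff_eq_neg.1 h2)
  -- hence `u (5k) = -λ^k`
  have hpow : ∀ k, u (5 * k) = -l ^ k := by
    intro k
    induction k with
    | zero => simpa using hzero
    | succ k ih =>
      rw [show 5 * (k + 1) = 5 * k + 5 by ring, hsucc, ih, pow_succ]
      ring
  -- degree bound: `deg h_μ ≤ 50` for `μ ∈ p`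
  have hbound : ∀ μ, p μ → (h μ).totalDegree ≤ 50 := by
    intro μ hμ
    refine cv_totalDegree_le_of_mul (h μ) (c μ) (hc μ) (hc0 μ hμ) ?_
    have := hdeg μ
    rwa [hP, if_pos hμ] at this
  -- so `u 55 = 0`
  have h55 : u 55 = 0 := by
    rw [hu]
    refine Finset.sum_eq_zero fun μ _ => ?_
    split_ifs with hμ
    · rw [homogeneousComponent_eq_zero _ _ (lt_of_le_of_lt (hbound μ hμ) (by norm_num)), map_zero]
    · rfl
  have h11 := hpow 11
  rw [show 5 * 11 = 55 by norm_num, h55] at h11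
  exact neg_eq_zero.1 h11.symm

/-! ## The converse transfer -/

/-- `SmallCaseThreeFive → UnivNilp 11`: a degree-`55` Nullstellensatz certificate forces
`λ ^ 11 = 0` in EVERY model (commutative `ℂ`-algebra `T`, `5 × 5` affine pencil with
`det = λ · per₃`).  Proof: evaluate the degree-`m` homogeneous components of `Σ_μ h_μ P_μ = 1` at
the model (`c_μ ↦ λ [μ ∈ Perm]`): with `u_m := Σ_ρ φ((h_ρ)_m)` one gets `u_0 = -1`,
`u_{m+5} = λ u_m`, so `u_{55} = -λ^11`, while `deg h_ρ ≤ 50` (as `deg (h_ρ (c_ρ - 1)) ≤ 55`,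
`c_ρ ≠ 0` quintic, `S` a domain) gives `u_{55} = 0`.  Hence a single model with `λ ^ 11 ≠ 0`
refutes the crux. -/
theorem stub_univNilp_of_smallCaseThreeFive (h : Theses.RefutationDegree.SmallCaseThreeFive) :
    ∀ (T : Type) [CommRing T] [Algebra ℂ T] (A₀ : Matrix (Fin 5) (Fin 5) T)
      (A : Fin 3 × Fin 3 → Matrix (Fin 5) (Fin 5) T) (l : T),
      (Matrix.of fun i j : Fin 5 => C (A₀ i j) + ∑ e : Fin 3 × Fin 3, X e * C (A e i j) :
          Matrix (Fin 5) (Fin 5) (MvPolynomial (Fin 3 × Fin 3) T)).det = C l * perPoly (Fin 3) T →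
        l ^ 11 = 0 := by
  intro T _ _ A₀ A l hdet
  obtain ⟨hh, hdeg, hsum⟩ := h
  -- the evaluation `φ : S →+* T` at the model, and the model pencil in terms of `φ`
  set φ : MvPolynomial (Option (Fin 3 × Fin 3) × (Fin 5 × Fin 5)) ℂ →+* T :=
    eval₂Hom (algebraMap ℂ T) fun v => v.1.elim (A₀ v.2.1 v.2.2) fun e => A e v.2.1 v.2.2 with hφ
  have hdetφ : (Matrix.of fun i j : Fin 5 =>
      C (φ (X (none, (i, j)))) + ∑ e : Fin 3 × Fin 3, X e * C (φ (X (some e, (i, j))))).det =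
        C l * perPoly (Fin 3) T := by
    simpa only [hφ, eval₂Hom_X', Option.elim_none, Option.elim_some] using hdet
  refine cv_univNilp_core φ l (fun μ => μ ∈ Set.range (permMonomial (n := Fin 3))) _ _ _ hh
    (fun μ => stub_coef_isHomogeneous μ) ?_ (cv_apply_coeff_of_det_eq φ l hdetφ)
    (fun μ => stub_defect_coeff _ μ) hdeg hsum
  rintro μ ⟨ρ, rfl⟩
  exact cv_coeff_permMonomial_ne_zero ρ

end Summit.ValiantsHypothesis.ValiantsHypothesis.Theorems.RefutationDegreeSmallCaseThreeFive
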